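import Literature.NumberTheory.Adeles.CompactSubgroupStabilisesLattice
import Literature.LinearAlgebra.FreeModule.IntegralFrobeniusFrame
import HarnessLib

/-!
# Compact subgroups of `GL_n(𝔸_{ℚ,f})` stabilise a lattice STABLE UNDER A COMMUTING ORDER

Topic `Literature/NumberTheory/Adeles`; theorems only (no definition, no named fact, no instance).

**Theorem** (`exists_rat_conj_entries_mem_integralFiniteAdeles_of_commute`).  Let `C ≤ GL_n(𝔸_{ℚ,f})` be a compact subgroup and
`S : ι → M_n(ℚ)` a finite family of rational matrices whose `ℤ`-span `𝒜 = Σ ℤ·S_k` contains `1` and is closed under products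
(an ORDER of commuting or non-commuting matrices, e.g. the scalars `𝓞_M` of a number field acting on `M^m` read in a `ℚ`-basis),
such that every `S_k` commutes with every `c ∈ C` (adelically).  Then there is `γ ∈ GL_n(ℚ)` with BOTH
* `γ c γ⁻¹`, `γ c⁻¹ γ⁻¹` integral (entries in `ℤ̂`) for all `c ∈ C` — the conclusion of ★ `exists_rat_conj_entries_mem_integralFiniteAdeles`, and
* `γ S_k γ⁻¹ ∈ M_n(ℤ)` for all `k`,
i.e. the full `ℤ`-lattice `Λ = γ⁻¹ℤⁿ` is `C`-stable (`c Λ̂ = Λ̂`) AND an `𝒜`-module.  Proof: take `γ₁` from the ★ theorem, replace the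
`C`-stable lattice `Λ₁ = γ₁⁻¹ℤⁿ` by `Λ₂ := 𝒜·Λ₁ = Σ_k S_k Λ₁` (still a full lattice since `1 ∈ 𝒜`, sandwiched `Λ₁ ⊆ Λ₂ ⊆ d⁻¹Λ₁`, hence free
of rank `n`: ★ `nonempty_basis_of_sandwiched`); `Λ₂` is an `𝒜`-module because `𝒜` is closed under products, and `C`-stable because `C` commutes
with `𝒜`: in matrices, with `Λ₂ = Pℤⁿ`, `P = Σ_k S_k Z_k`, `S_k = P Y_k` (`Y_k, Z_k` integral), one has `P⁻¹ c P = Σ_k Y_k c Z_k ∈ M_n(ℤ̂)` and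
`P⁻¹ S_l P = Σ_{k,m} a_{lkm} Y_m Z_k ∈ M_n(ℤ)`.  [cite: PlatonovRapinchuk1994, §8.1] (compact subgroups fix lattices; here refined to lattices
over an order, as in the PEL setting of [cite: Kottwitz1992, §5 p. 390] where the level stabilises an `𝒪_B`-lattice).

Consumer: cell hodgecm-mathlib P6 door (E), organ E1 FILE 7 (`UnitaryCurveAuxiliaryIntegralActionV`): the symplectic frame of the auxiliary
chart must be adapted to an `𝓞_M`-STABLE lattice for the `𝓞`-action to read as INTEGER matrices (`AuxChartGS.Mρ`).

## References
* V. Platonov, A. Rapinchuk, *Algebraic groups and number theory* (1994), §8.1. [PlatonovRapinchuk1994]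
* R. Kottwitz, *Points on some Shimura varieties over finite fields*, JAMS 5 (1992), §5 p. 390. [Kottwitz1992]
-/

set_option autoImplicit false

noncomputable section

open scoped Matrix
open NumberField IsDedekindDomain Matrix
open Literature.NumberTheory.Automorphic (integralFiniteAdeles)
open Literature.LinearAlgebra.FreeModule (exists_nat_pos_mul_integral)

namespace Literature.NumberTheory.Adeles

variable {n : Type} [Fintype n] [DecidableEq n]

/-! ### §1. The refinement for an already integral group -/

section Integral

/-- **Refinement step.**  Let every `c ∈ C₁ ≤ GL_n(𝔸_{ℚ,f})` have integral entries and integral inverse entries (`C₁ ≤ GL_n(ℤ̂)`),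
and let `S : ι → M_n(ℚ)` be a finite family with `1 ∈ span_ℤ S`, `S_k S_l ∈ span_ℤ S`, each `S_k` commuting with `C₁`.  Then some
`γ ∈ GL_n(ℚ)` conjugates `C₁` into `GL_n(ℤ̂)` AND every `S_k` into `M_n(ℤ)` (the lattice `Σ_k S_k ℤⁿ`). [cite: PlatonovRapinchuk1994, §8.1] -/
theorem exists_rat_conj_integral_and_intCast_of_integral {ι : Type} [Fintype ι]
    (C₁ : Subgroup (GL n (FiniteAdeleRing (𝓞 ℚ) ℚ)))
    (hC₁ : ∀ c ∈ C₁, (∀ i j, ((c : GL n (FiniteAdeleRing (𝓞 ℚ) ℚ)) : Matrix n n (FiniteAdeleRing (𝓞 ℚ) ℚ)) i j ∈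
        integralFiniteAdeles ℚ) ∧
      ∀ i j, ((c⁻¹ : GL n (FiniteAdeleRing (𝓞 ℚ) ℚ)) : Matrix n n (FiniteAdeleRing (𝓞 ℚ) ℚ)) i j ∈ integralFiniteAdeles ℚ)
    (S : ι → Matrix n n ℚ) (h1 : (1 : Matrix n n ℚ) ∈ Submodule.span ℤ (Set.range S))
    (hmul : ∀ k l, S k * S l ∈ Submodule.span ℤ (Set.range S))
    (hcomm : ∀ k, ∀ c ∈ C₁, (S k).map (algebraMap ℚ (FiniteAdeleRing (𝓞 ℚ) ℚ)) * (c : Matrix n n (FiniteAdeleRing (𝓞 ℚ) ℚ)) =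
      (c : Matrix n n (FiniteAdeleRing (𝓞 ℚ) ℚ)) * (S k).map (algebraMap ℚ (FiniteAdeleRing (𝓞 ℚ) ℚ))) :
    ∃ γ : GL n ℚ,
      (∀ c ∈ C₁,
        (∀ i j, ((Matrix.GeneralLinearGroup.map (algebraMap ℚ (FiniteAdeleRing (𝓞 ℚ) ℚ)) γ * c *
            (Matrix.GeneralLinearGroup.map (algebraMap ℚ (FiniteAdeleRing (𝓞 ℚ) ℚ)) γ)⁻¹ :
              GL n (FiniteAdeleRing (𝓞 ℚ) ℚ)) : Matrix n n (FiniteAdeleRing (𝓞 ℚ) ℚ)) i j ∈ integralFiniteAdeles ℚ) ∧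
        (∀ i j, ((Matrix.GeneralLinearGroup.map (algebraMap ℚ (FiniteAdeleRing (𝓞 ℚ) ℚ)) γ * c⁻¹ *
            (Matrix.GeneralLinearGroup.map (algebraMap ℚ (FiniteAdeleRing (𝓞 ℚ) ℚ)) γ)⁻¹ :
              GL n (FiniteAdeleRing (𝓞 ℚ) ℚ)) : Matrix n n (FiniteAdeleRing (𝓞 ℚ) ℚ)) i j ∈ integralFiniteAdeles ℚ)) ∧
      ∀ k i j, ∃ z : ℤ, ((γ : Matrix n n ℚ) * S k * ((γ⁻¹ : GL n ℚ) : Matrix n n ℚ)) i j = (z : ℚ) := by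
  classical
  -- abbreviations
  let A := FiniteAdeleRing (𝓞 ℚ) ℚ
  let f : ℚ →+* A := algebraMap ℚ A
  let O := integralFiniteAdeles ℚ
  -- Step 0: coefficients of `1` and of the products in the family
  obtain ⟨e, he⟩ := (Submodule.mem_span_range_iff_exists_fun ℤ).mp h1
  choose a ha using fun k l => (Submodule.mem_span_range_iff_exists_fun ℤ).mp (hmul k l)
  -- Step 1: a common denominator `d` of all `S_k`
  obtain ⟨d, hd, zS, hzS⟩ := exists_nat_pos_mul_integral (fun p : ι × n × n => S p.1 p.2.1 p.2.2)
  have hdQ : (d : ℚ) ≠ 0 := Nat.cast_ne_zero.mpr hd.ne'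
  -- Step 2: the lattice `Λ := Σ_k (d • S_k) ℤⁿ`, spanned by the columns of the `d • S_k`
  let v : ι × n → (n → ℚ) := fun p i => (d : ℚ) * S p.1 i p.2
  let Λ : Submodule ℤ (n → ℚ) := Submodule.span ℤ (Set.range v)
  have hv_mem : ∀ p, v p ∈ Λ := fun p => Submodule.subset_span (Set.mem_range_self p)
  have hΛint : ∀ q ∈ Λ, ∀ i, ∃ z : ℤ, (z : ℚ) = q i := by
    intro q hq
    refine Submodule.span_induction (p := fun q _ => ∀ i, ∃ z : ℤ, (z : ℚ) = q i) ?_ ?_ ?_ ?_ hq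
    · rintro _ ⟨p, rfl⟩ i
      exact ⟨zS (p.1, i, p.2), hzS (p.1, i, p.2) ▸ rfl⟩
    · intro i
      exact ⟨0, by simp⟩
    · intro x y _ _ hx hy i
      obtain ⟨zx, hzx⟩ := hx i
      obtain ⟨zy, hzy⟩ := hy i
      exact ⟨zx + zy, by rw [Int.cast_add, hzx, hzy, Pi.add_apply]⟩
    · intro m x _ hx i
      obtain ⟨zx, hzx⟩ := hx i
      exact ⟨m * zx, by rw [Int.cast_mul, hzx, Pi.smul_apply, zsmul_eq_mul]⟩
  -- `d • eᵢ ∈ Λ` from `1 = Σ_k e_k S_k`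
  have hΛstd : ∀ i, ((d : ℚ) • Pi.single i 1 : n → ℚ) ∈ Λ := by
    intro i
    have h : ((d : ℚ) • Pi.single i 1 : n → ℚ) = ∑ k, (e k : ℤ) • v (k, i) := by
      funext i'
      have h1' := congrFun (congrFun he i') i
      rw [Matrix.sum_apply] at h1'
      rw [Pi.smul_apply, Finset.sum_apply, smul_eq_mul, Matrix.one_apply] at *
      simp only [Pi.smul_apply, zsmul_eq_mul, v, Pi.single_apply]
      rw [← h1']
      simp only [Matrix.smul_apply, zsmul_eq_mul, Finset.mul_sum]
      refine Finset.sum_congr rfl fun k _ => ?_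
      ring
    rw [h]
    exact Submodule.sum_mem _ fun k _ => Submodule.smul_mem _ _ (hv_mem (k, i))
  -- Step 3: a `ℤ`-basis of `Λ`, its matrix `P` (`Λ = P ℤⁿ`) and `P⁻¹ = d⁻¹ Zc`
  obtain ⟨b⟩ := nonempty_basis_of_sandwiched Λ hd.ne' hΛstd hΛint
  let P : Matrix n n ℚ := fun i j => ((b j : Λ) : n → ℚ) i
  have hPcol : ∀ j, (fun i => P i j) ∈ Λ := fun j => (b j).2
  have hPspan : ∀ q ∈ Λ, ∃ z : n → ℤ, q = P *ᵥ fun j => (z j : ℚ) := by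
    intro q hq
    refine ⟨fun j => b.repr ⟨q, hq⟩ j, ?_⟩
    have h := b.sum_repr ⟨q, hq⟩
    have h' : q = ∑ j, (b.repr ⟨q, hq⟩ j : ℤ) • ((b j : Λ) : n → ℚ) := by
      have := congrArg (fun x : Λ => (x : n → ℚ)) h
      simpa only [Submodule.coe_sum, Submodule.coe_smul_of_tower] using this.symm
    funext i
    rw [congrFun h' i, Finset.sum_apply, Matrix.mulVec, dotProduct]
    refine Finset.sum_congr rfl fun j _ => ?_
    rw [Pi.smul_apply, zsmul_eq_mul, mul_comm]
  choose zcol hzcol using fun j => hPspan _ (hΛstd j)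
  let Zc : Matrix n n ℚ := fun i j => (zcol j i : ℚ)
  have hPZ : P * Zc = (d : ℚ) • (1 : Matrix n n ℚ) := by
    ext i j
    have h := congrFun (hzcol j) i
    rw [Pi.smul_apply, smul_eq_mul] at h
    rw [Matrix.mul_apply, Matrix.smul_apply, smul_eq_mul, Matrix.one_apply, Pi.single_apply] at *
    rw [h, Matrix.mulVec, dotProduct]
  let Pinv : Matrix n n ℚ := (d : ℚ)⁻¹ • Zc
  have hPPinv : P * Pinv = 1 := by
    rw [Matrix.mul_smul, hPZ, smul_smul, inv_mul_cancel₀ hdQ, one_smul]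
  have hPinvP : Pinv * P = 1 := mul_eq_one_comm.mp hPPinv
  let γ : GL n ℚ := ⟨Pinv, P, hPinvP, hPPinv⟩
  -- Step 4: the two integer decompositions `P = Σ_k (d • S_k) Z_k` and `d • S_k = P Y_k`
  choose cP hcP using fun j => (Submodule.mem_span_range_iff_exists_fun ℤ).mp (hPcol j)
  let Zz : ι → Matrix n n ℤ := fun k r j => cP j (k, r)
  choose yv hyv using fun p => hPspan _ (hv_mem p)
  let Yz : ι → Matrix n n ℤ := fun k r j => yv (k, j) r
  let φ : Matrix n n ℤ →+* Matrix n n ℚ := (Int.castRingHom ℚ).mapMatrix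
  have hφ : ∀ M : Matrix n n ℤ, φ M = M.map (Int.cast : ℤ → ℚ) := fun M => by
    rw [RingHom.mapMatrix_apply, Int.coe_castRingHom]
  have hPdec : P = ∑ k, ((d : ℚ) • S k) * φ (Zz k) := by
    ext i j
    have h := congrFun (hcP j) i
    rw [Finset.sum_apply, Fintype.sum_prod_type] at h
    rw [← h, Matrix.sum_apply]
    refine Finset.sum_congr rfl fun k _ => ?_
    rw [Matrix.mul_apply]
    refine Finset.sum_congr rfl fun r _ => ?_
    rw [hφ, Matrix.map_apply, Matrix.smul_apply, Pi.smul_apply, zsmul_eq_mul, smul_eq_mul, mul_comm]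
  have hSdec : ∀ k, (d : ℚ) • S k = P * φ (Yz k) := fun k => by
    ext i j
    have h := congrFun (hyv (k, j)) i
    rw [Matrix.smul_apply, smul_eq_mul, Matrix.mul_apply]
    change v (k, j) i = _ at h
    rw [show (d : ℚ) * S k i j = v (k, j) i from rfl, h, Matrix.mulVec, dotProduct]
    refine Finset.sum_congr rfl fun r _ => ?_
    rw [hφ, Matrix.map_apply]
  -- Step 5 (b): `P⁻¹ S_l P = Σ_{k,m} a_{lkm} Y_m Z_k` is an integer matrix
  have hSP : ∀ l, S l * P = P * φ (∑ k, ∑ m, a l k m • (Yz m * Zz k)) := by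
    intro l
    rw [map_sum, Finset.mul_sum]
    conv_lhs => rw [hPdec, Finset.mul_sum]
    refine Finset.sum_congr rfl fun k _ => ?_
    rw [← Matrix.mul_assoc, mul_smul_comm, ← ha l k, Finset.smul_sum, Finset.sum_mul, map_sum, Finset.mul_sum]
    refine Finset.sum_congr rfl fun m _ => ?_
    rw [map_zsmul, map_mul, mul_smul_comm, ← Matrix.mul_assoc, ← hSdec m, smul_comm (d : ℚ) (a l k m) (S m),
      smul_mul_assoc]
  have hconjS : ∀ l, Pinv * S l * P = φ (∑ k, ∑ m, a l k m • (Yz m * Zz k)) := fun l => by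
    rw [Matrix.mul_assoc, hSP l, ← Matrix.mul_assoc, hPinvP, Matrix.one_mul]
  -- Step 6 (a): `P⁻¹ c P = Σ_k Y_k c Z_k` is integral for `c ∈ C₁`
  have hφf : ∀ (M : Matrix n n ℤ) (i j : n), ((φ M).map f) i j ∈ O := fun M i j => by
    rw [Matrix.map_apply, hφ, Matrix.map_apply]
    exact algebraMap_intCast_mem_integralFiniteAdeles _
  have key : ∀ c ∈ C₁, ∀ i j, (Pinv.map f * (c : Matrix n n A) * P.map f) i j ∈ O := by
    intro c hc i j
    have hdS : ∀ k, ((d : ℚ) • S k).map f * (c : Matrix n n A) = (c : Matrix n n A) * ((d : ℚ) • S k).map f := fun k => by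
      rw [Matrix.map_smul' _ _ _ (map_mul f), Matrix.smul_mul, Matrix.mul_smul, hcomm k c hc]
    have hcP' : (c : Matrix n n A) * P.map f = P.map f * ∑ k, (φ (Yz k)).map f * (c : Matrix n n A) * (φ (Zz k)).map f := by
      conv_lhs => rw [hPdec]
      rw [← RingHom.mapMatrix_apply f, map_sum, Finset.mul_sum, Finset.mul_sum]
      refine Finset.sum_congr rfl fun k _ => ?_
      rw [map_mul, RingHom.mapMatrix_apply, RingHom.mapMatrix_apply, ← Matrix.mul_assoc, ← hdS k, hSdec k,
        ← RingHom.mapMatrix_apply f, map_mul, RingHom.mapMatrix_apply, RingHom.mapMatrix_apply]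
      simp only [Matrix.mul_assoc]
    have hPinvPf : Pinv.map f * P.map f = 1 := by
      rw [← RingHom.mapMatrix_apply, ← RingHom.mapMatrix_apply, ← map_mul, hPinvP, map_one]
    rw [Matrix.mul_assoc, hcP', ← Matrix.mul_assoc, hPinvPf, Matrix.one_mul, Matrix.sum_apply]
    refine sum_mem fun k _ => ?_
    rw [Matrix.mul_apply]
    refine sum_mem fun r _ => mul_mem ?_ (hφf _ _ _)
    rw [Matrix.mul_apply]
    exact sum_mem fun r' _ => mul_mem (hφf _ _ _) ((hC₁ c hc).1 r' r)
  -- adelic images of `γ`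
  have hγA : ((Matrix.GeneralLinearGroup.map f γ : GL n A) : Matrix n n A) = Pinv.map f := rfl
  have hγAinv : (((Matrix.GeneralLinearGroup.map f γ)⁻¹ : GL n A) : Matrix n n A) = P.map f := by
    rw [← map_inv]; rfl
  refine ⟨γ, fun c hc => ⟨fun i j => ?_, fun i j => ?_⟩, fun k i j => ?_⟩
  · rw [Units.val_mul, Units.val_mul, hγA, hγAinv]
    exact key c hc i j
  · rw [Units.val_mul, Units.val_mul, hγA, hγAinv]
    exact key c⁻¹ (C₁.inv_mem hc) i j
  · refine ⟨(∑ k', ∑ m, a k k' m • (Yz m * Zz k')) i j, ?_⟩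
    change (Pinv * S k * P) i j = _
    rw [hconjS k, hφ, Matrix.map_apply]

end Integral

/-! ### §2. The theorem: a compact subgroup and a commuting order stabilise a common lattice -/

section Main

/-- **Compact subgroups of `GL_n(𝔸_{ℚ,f})` stabilise a lattice over any commuting order.**  For a compact subgroup
`C ≤ GL_n(𝔸_{ℚ,f})` and a finite family `S : ι → M_n(ℚ)` whose `ℤ`-span contains `1` and is closed under products, each `S_k`
commuting (adelically) with every `c ∈ C`, there is `γ ∈ GL_n(ℚ)` such that `γ c γ⁻¹` and `γ c⁻¹ γ⁻¹` are integral for all `c ∈ C`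
(★ `exists_rat_conj_entries_mem_integralFiniteAdeles`, same clause) AND every `γ S_k γ⁻¹` is an INTEGER matrix: the full lattice
`Λ = γ⁻¹ ℤⁿ` is `C`-stable and a module over the order `Σ_k ℤ S_k`. [cite: PlatonovRapinchuk1994, §8.1] [cite: Kottwitz1992, §5 p. 390] -/
theorem exists_rat_conj_entries_mem_integralFiniteAdeles_of_commute {ι : Type} [Fintype ι]
    (C : Subgroup (GL n (FiniteAdeleRing (𝓞 ℚ) ℚ))) (hC : IsCompact (C : Set (GL n (FiniteAdeleRing (𝓞 ℚ) ℚ))))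
    (S : ι → Matrix n n ℚ) (h1 : (1 : Matrix n n ℚ) ∈ Submodule.span ℤ (Set.range S))
    (hmul : ∀ k l, S k * S l ∈ Submodule.span ℤ (Set.range S))
    (hcomm : ∀ k, ∀ c ∈ C, (S k).map (algebraMap ℚ (FiniteAdeleRing (𝓞 ℚ) ℚ)) * (c : Matrix n n (FiniteAdeleRing (𝓞 ℚ) ℚ)) =
      (c : Matrix n n (FiniteAdeleRing (𝓞 ℚ) ℚ)) * (S k).map (algebraMap ℚ (FiniteAdeleRing (𝓞 ℚ) ℚ))) :
    ∃ γ : GL n ℚ,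
      (∀ c ∈ C,
        (∀ i j, ((Matrix.GeneralLinearGroup.map (algebraMap ℚ (FiniteAdeleRing (𝓞 ℚ) ℚ)) γ * c *
            (Matrix.GeneralLinearGroup.map (algebraMap ℚ (FiniteAdeleRing (𝓞 ℚ) ℚ)) γ)⁻¹ :
              GL n (FiniteAdeleRing (𝓞 ℚ) ℚ)) : Matrix n n (FiniteAdeleRing (𝓞 ℚ) ℚ)) i j ∈ integralFiniteAdeles ℚ) ∧
        (∀ i j, ((Matrix.GeneralLinearGroup.map (algebraMap ℚ (FiniteAdeleRing (𝓞 ℚ) ℚ)) γ * c⁻¹ *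
            (Matrix.GeneralLinearGroup.map (algebraMap ℚ (FiniteAdeleRing (𝓞 ℚ) ℚ)) γ)⁻¹ :
              GL n (FiniteAdeleRing (𝓞 ℚ) ℚ)) : Matrix n n (FiniteAdeleRing (𝓞 ℚ) ℚ)) i j ∈ integralFiniteAdeles ℚ)) ∧
      ∀ k i j, ∃ z : ℤ, ((γ : Matrix n n ℚ) * S k * ((γ⁻¹ : GL n ℚ) : Matrix n n ℚ)) i j = (z : ℚ) := by
  classical
  let A := FiniteAdeleRing (𝓞 ℚ) ℚ
  let f : ℚ →+* A := algebraMap ℚ A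
  -- Step 1: a first `C`-stable lattice `γ₁⁻¹ ℤⁿ`
  obtain ⟨γ₁, hγ₁⟩ := exists_rat_conj_entries_mem_integralFiniteAdeles C hC
  set γm : Matrix n n ℚ := (γ₁ : Matrix n n ℚ) with hγm
  set γi : Matrix n n ℚ := ((γ₁⁻¹ : GL n ℚ) : Matrix n n ℚ) with hγi
  have hγiγm : γi * γm = 1 := by rw [hγm, hγi, ← Units.val_mul, inv_mul_cancel, Units.val_one]
  have hγmγi : γm * γi = 1 := by rw [hγm, hγi, ← Units.val_mul, mul_inv_cancel, Units.val_one]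
  set g₁ : GL n A := Matrix.GeneralLinearGroup.map f γ₁ with hg₁def
  have hg₁ : ((g₁ : GL n A) : Matrix n n A) = γm.map f := rfl
  have hg₁i : ((g₁⁻¹ : GL n A) : Matrix n n A) = γi.map f := by rw [hg₁def, ← map_inv]; rfl
  have hGiG : γi.map f * γm.map f = 1 := by
    rw [← RingHom.mapMatrix_apply, ← RingHom.mapMatrix_apply, ← map_mul, hγiγm, map_one]
  -- Step 2: transport `C` and `S` by `γ₁`
  let C₁ : Subgroup (GL n A) := C.map (MulAut.conj g₁).toMonoidHom
  have hC₁mem : ∀ c₁ ∈ C₁, ∃ c ∈ C, c₁ = g₁ * c * g₁⁻¹ := by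
    intro c₁ hc₁
    obtain ⟨c, hc, rfl⟩ := Subgroup.mem_map.mp hc₁
    exact ⟨c, hc, rfl⟩
  have hC₁ : ∀ c₁ ∈ C₁, (∀ i j, ((c₁ : GL n A) : Matrix n n A) i j ∈ integralFiniteAdeles ℚ) ∧
      ∀ i j, ((c₁⁻¹ : GL n A) : Matrix n n A) i j ∈ integralFiniteAdeles ℚ := by
    intro c₁ hc₁
    obtain ⟨c, hc, rfl⟩ := hC₁mem c₁ hc₁
    have hinv : (g₁ * c * g₁⁻¹)⁻¹ = g₁ * c⁻¹ * g₁⁻¹ := by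
      rw [_root_.mul_inv_rev, _root_.mul_inv_rev, inv_inv, mul_assoc]
    rw [hinv]
    exact hγ₁ c hc
  let κ : Matrix n n ℚ →ₗ[ℤ] Matrix n n ℚ := (LinearMap.mulLeft ℤ γm).comp (LinearMap.mulRight ℤ γi)
  have hκ : ∀ X, κ X = γm * (X * γi) := fun X => by
    simp only [κ, LinearMap.comp_apply, LinearMap.mulLeft_apply, LinearMap.mulRight_apply]
  let S₁ : ι → Matrix n n ℚ := κ ∘ S
  have hS₁ : ∀ k, S₁ k = γm * (S k * γi) := fun k => hκ (S k)
  have hspan : ∀ x ∈ Submodule.span ℤ (Set.range S), κ x ∈ Submodule.span ℤ (Set.range S₁) := by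
    intro x hx
    rw [show Set.range S₁ = κ '' Set.range S from Set.range_comp κ S, Submodule.span_image]
    exact Submodule.mem_map_of_mem hx
  have h1' : (1 : Matrix n n ℚ) ∈ Submodule.span ℤ (Set.range S₁) := by
    have h := hspan 1 h1
    rwa [hκ, Matrix.one_mul, hγmγi] at h
  have hmul' : ∀ k l, S₁ k * S₁ l ∈ Submodule.span ℤ (Set.range S₁) := by
    intro k l
    have h := hspan _ (hmul k l)
    have heq : S₁ k * S₁ l = κ (S k * S l) := by
      rw [hS₁, hS₁, hκ]
      simp only [Matrix.mul_assoc]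
      rw [← Matrix.mul_assoc γi γm (S l * γi), hγiγm, Matrix.one_mul]
    rwa [heq]
  have hcomm' : ∀ k, ∀ c₁ ∈ C₁, (S₁ k).map f * (c₁ : Matrix n n A) = (c₁ : Matrix n n A) * (S₁ k).map f := by
    intro k c₁ hc₁
    obtain ⟨c, hc, rfl⟩ := hC₁mem c₁ hc₁
    have hSf : (S₁ k).map f = γm.map f * ((S k).map f * γi.map f) := by
      rw [hS₁, ← RingHom.mapMatrix_apply, map_mul, map_mul]
      rfl
    rw [hSf, Units.val_mul, Units.val_mul, hg₁, hg₁i]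
    simp only [Matrix.mul_assoc]
    rw [← Matrix.mul_assoc (γi.map f) (γm.map f) ((c : Matrix n n A) * γi.map f), hGiG, Matrix.one_mul,
      ← Matrix.mul_assoc (γi.map f) (γm.map f) ((S k).map f * γi.map f), hGiG, Matrix.one_mul,
      ← Matrix.mul_assoc ((S k).map f) (c : Matrix n n A) (γi.map f), hcomm k c hc, Matrix.mul_assoc]
  -- Step 3: refine by the integral step
  obtain ⟨γ₂, hγ₂C, hγ₂S⟩ := exists_rat_conj_integral_and_intCast_of_integral C₁ hC₁ S₁ h1' hmul' hcomm'
  refine ⟨γ₂ * γ₁, fun c hc => ?_, fun k i j => ?_⟩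
  · have hmem : g₁ * c * g₁⁻¹ ∈ C₁ := Subgroup.mem_map_of_mem _ hc
    have hconj : Matrix.GeneralLinearGroup.map f (γ₂ * γ₁) * c * (Matrix.GeneralLinearGroup.map f (γ₂ * γ₁))⁻¹ =
        Matrix.GeneralLinearGroup.map f γ₂ * (g₁ * c * g₁⁻¹) * (Matrix.GeneralLinearGroup.map f γ₂)⁻¹ := by
      rw [map_mul, _root_.mul_inv_rev, hg₁def]
      simp only [mul_assoc]
    have hconj' : Matrix.GeneralLinearGroup.map f (γ₂ * γ₁) * c⁻¹ * (Matrix.GeneralLinearGroup.map f (γ₂ * γ₁))⁻¹ =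
        Matrix.GeneralLinearGroup.map f γ₂ * (g₁ * c * g₁⁻¹)⁻¹ * (Matrix.GeneralLinearGroup.map f γ₂)⁻¹ := by
      rw [map_mul, _root_.mul_inv_rev, _root_.mul_inv_rev, _root_.mul_inv_rev, inv_inv, hg₁def]
      simp only [mul_assoc]
    refine ⟨fun i j => ?_, fun i j => ?_⟩
    · rw [hconj]; exact (hγ₂C _ hmem).1 i j
    · rw [hconj']; exact (hγ₂C _ hmem).2 i j
  · obtain ⟨z, hz⟩ := hγ₂S k i j
    refine ⟨z, ?_⟩
    rw [← hz, Units.val_mul, _root_.mul_inv_rev, Units.val_mul, hS₁]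
    simp only [Matrix.mul_assoc, hγm, hγi]

end Main

end Literature.NumberTheory.Adeles

end
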